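import Mathlib.MeasureTheory.Integral.MeanInequalities
import Mathlib.MeasureTheory.Function.L2Space
import Literature.Analysis.FunctionSpaces.PeriodicLogCostDeriv
import Literature.Analysis.FunctionSpaces.LadyzhenskayaTorus
import Literature.Analysis.SingularIntegrals.TorusMaximalTwoPointInequality
import Literature.Analysis.FluidPDE.TwoPointPairFunctional
import HarnessLib

/-!
# Slice bounds for the two-point functional with the periodic logarithmic cost

Analysis/FluidPDE proof-support file (everything proved). For a probability density `f` on
`T^d` (continuous, `f ≥ 0`, `∫ f = 1`), a smooth field `v` and the smooth periodic logarithmic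
cost `Φ_δ = Torus.sinLogCost δ` (`FunctionSpaces/PeriodicLogCost(Deriv)`), the two terms of the
generator of the pair functional `∫∫ Φ_δ(x-y) f(x) f(y)` (`FluidPDE/TwoPointPairFunctional`) obey

* **transport** (`two_mul_integral_integral_inner_gradient_le`):
  `2 ∫ f(x) ∫ f(y) v(x)·∇Φ_δ(x-y) ≤ 2π ∫ Ψ f`, where `Ψ` is any two-point majorant of `v`,
  `‖v x - v y‖ ≤ dist x y (Ψ x + Ψ y)` — symmetrise with the odd `∇Φ_δ` and use
  `‖z‖ ‖∇Φ_δ(z)‖ ≤ π`;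
* **diffusion** (`two_mul_integral_integral_laplacian_le`):
  `2 ∫ f(x) ∫ f(y) κ ΔΦ_δ(x-y) ≤ 4π² d` for `κ = δ²` (`ΔΦ_δ ≤ 2π² d/δ²`);
* the real-valued two-point maximal majorant of a smooth field with
  `∫ Ψ ≤ (C_d · d · ‖∇v‖²_{L²})^{1/2}` (`exists_real_twoPoint_majorant`, from
  `Torus.exists_twoPoint_maximal`).

These are the slice-wise inequalities of the two-point (Crippa–De Lellis / Seis type) argument
bounding the logarithmic separation functional by the time-integrated `L²` strain.

## References

* G. Crippa, C. De Lellis, J. reine angew. Math. 616 (2008), §2.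
* C. Seis, Comm. Math. Phys. 399 (2023) = arXiv:2003.08794, Lemma 3. [`Seis2022`]
-/

noncomputable section

open MeasureTheory Set Filter Topology Function Metric Real
open scoped InnerProductSpace ENNReal
open Literature.Analysis.FunctionSpaces Literature.Analysis.FunctionSpaces.Torus
open Literature.Analysis.SingularIntegrals Literature.Analysis.SingularIntegrals.Torus

namespace Literature.Analysis.FluidPDE

namespace Torus

variable {d : Type*} [Fintype d] [DecidableEq d]

/-! ## The real two-point majorant of a smooth field -/

omit [DecidableEq d] in
/-- `∫ Ψ ≤ √(∫ Ψ²)` on the probability space `T^d`, for `Ψ ≥ 0` in `L²`. [folklore] -/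
theorem integral_le_sqrt_integral_sq_of_memLp_two {Ψ : UnitAddTorus d → ℝ} (hΨ : MemLp Ψ 2 volume) (hΨ0 : ∀ x, 0 ≤ Ψ x) :
    ∫ x, Ψ x ≤ Real.sqrt (∫ x, Ψ x ^ 2) := by
  have h := integral_mul_le_Lp_mul_Lq_of_nonneg Real.HolderConjugate.two_two
    (f := Ψ) (g := fun _ => (1 : ℝ))
    (Eventually.of_forall hΨ0) (Eventually.of_forall fun x => zero_le_one)
    (by rw [ENNReal.ofReal_ofNat]; exact hΨ) (by rw [ENNReal.ofReal_ofNat]; exact memLp_const _)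
  simp only [mul_one, Real.rpow_two, one_pow, integral_const, smul_eq_mul] at h
  rw [← Real.sqrt_eq_rpow] at h
  simpa using h

/-- **The real two-point maximal majorant of a smooth field** (Hajłasz / Crippa–De Lellis
maximal-function Lipschitz estimate on `T^d`, `Torus.exists_twoPoint_maximal`, in real form):
`‖v x - v y‖ ≤ dist x y (Ψ x + Ψ y)` with `Ψ ≥ 0` measurable, `Ψ ∈ L²` and
`∫ Ψ ≤ (C_d · d · eGradNormSq v)^{1/2}`, `C_d = twoPointL2Const d`. [folklore] -/
theorem exists_real_twoPoint_majorant {v : UnitAddTorus d → EuclideanSpace ℝ d} (hv : IsSmooth v) :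
    ∃ Ψ : UnitAddTorus d → ℝ, Measurable Ψ ∧ (∀ x, 0 ≤ Ψ x) ∧
      (∀ x y, ‖v x - v y‖ ≤ dist x y * (Ψ x + Ψ y)) ∧ MemLp Ψ 2 volume ∧
      ∫ x, Ψ x ≤ Real.sqrt ((twoPointL2Const d).toReal * (Fintype.card d * (eGradNormSq v).toReal)) := by
  obtain ⟨Ψ, hΨm, hΨfin, h2pt, hL2⟩ := exists_twoPoint_maximal (hv.isContDiff (n := 1) (by simp))
  set Ψr : UnitAddTorus d → ℝ := fun x => (Ψ x).toReal with hΨr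
  have hΨr0 : ∀ x, 0 ≤ Ψr x := fun x => ENNReal.toReal_nonneg
  have hofReal : ∀ x, ENNReal.ofReal (Ψr x) = Ψ x := fun x => ENNReal.ofReal_toReal (hΨfin x).ne
  have h2r : ∀ x y, ‖v x - v y‖ ≤ dist x y * (Ψr x + Ψr y) := by
    intro x y
    have h := h2pt x y
    rw [← hofReal x, ← hofReal y, ← ENNReal.ofReal_add (hΨr0 x) (hΨr0 y),
      ← ENNReal.ofReal_mul dist_nonneg, ← ofReal_norm] at h
    exact (ENNReal.ofReal_le_ofReal_iff (by positivity)).1 h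
  have hΨrm : Measurable Ψr := hΨm.ennreal_toReal
  have hfin : ∫⁻ x, Ψ x ^ 2 < ∞ := by
    refine lt_of_le_of_lt hL2 (ENNReal.mul_lt_top (twoPointL2Const_lt_top d) ?_)
    exact lt_of_le_of_lt (lintegral_enorm_fderiv_sq_le_card_mul_eGradNormSq hv)
      (ENNReal.mul_lt_top (ENNReal.natCast_lt_top _) (eGradNormSq_lt_top hv))
  have hΨsq : ∀ x, ENNReal.ofReal (Ψr x ^ 2) = Ψ x ^ 2 := fun x => by
    rw [ENNReal.ofReal_pow (hΨr0 x), hofReal]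
  have hΨi : Integrable (fun x => Ψr x ^ 2) volume := by
    refine ⟨(hΨrm.pow_const 2).aestronglyMeasurable, ?_⟩
    rw [hasFiniteIntegral_iff_enorm]
    calc ∫⁻ x, ‖Ψr x ^ 2‖ₑ = ∫⁻ x, Ψ x ^ 2 := lintegral_congr fun x => by
          rw [Real.enorm_eq_ofReal (sq_nonneg _), hΨsq]
      _ < ∞ := hfin
  have hint : ∫ x, Ψr x ^ 2 = (∫⁻ x, Ψ x ^ 2).toReal := by
    rw [integral_eq_lintegral_of_nonneg_ae (Eventually.of_forall fun x => sq_nonneg _)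
      (hΨrm.pow_const 2).aestronglyMeasurable]
    congr 1
    exact lintegral_congr fun x => hΨsq x
  have hB : ∫ x, Ψr x ^ 2 ≤ (twoPointL2Const d).toReal * (Fintype.card d * (eGradNormSq v).toReal) := by
    rw [hint]
    have hne : twoPointL2Const d * (Fintype.card d * eGradNormSq v) ≠ ∞ :=
      (ENNReal.mul_lt_top (twoPointL2Const_lt_top d)
        (ENNReal.mul_lt_top (ENNReal.natCast_lt_top _) (eGradNormSq_lt_top hv))).ne
    have hle : ∫⁻ x, Ψ x ^ 2 ≤ twoPointL2Const d * (Fintype.card d * eGradNormSq v) :=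
      hL2.trans (mul_le_mul' le_rfl (lintegral_enorm_fderiv_sq_le_card_mul_eGradNormSq hv))
    have := ENNReal.toReal_mono hne hle
    rwa [ENNReal.toReal_mul, ENNReal.toReal_mul, ENNReal.toReal_natCast] at this
  have hΨ2 : MemLp Ψr 2 volume := (memLp_two_iff_integrable_sq hΨrm.aestronglyMeasurable).2 hΨi
  exact ⟨Ψr, hΨrm, hΨr0, h2r, hΨ2, (integral_le_sqrt_integral_sq_of_memLp_two hΨ2 hΨr0).trans (Real.sqrt_le_sqrt hB)⟩

/-! ## The transport term -/

omit [DecidableEq d] in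
/-- A bounded measurable factor times an integrable one is integrable (continuous `f` on `T^d`). [folklore] -/
theorem integrable_continuous_mul_of_integrable {f Ψ : UnitAddTorus d → ℝ} (hf : Continuous f) (hΨ : Integrable Ψ volume) :
    Integrable (fun x => f x * Ψ x) volume := by
  obtain ⟨C, hC⟩ := (isCompact_univ (X := UnitAddTorus d)).exists_bound_of_continuousOn hf.continuousOn
  exact hΨ.bdd_mul hf.aestronglyMeasurable (Eventually.of_forall fun x => hC x (mem_univ x))

/-- **The transport slice bound.** For a continuous probability density `f`, a continuous
field `v` with two-point majorant `Ψ ∈ L²` and the periodic logarithmic cost `Φ_δ` (`δ ≠ 0`):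
`2 ∫ f(x) ∫ f(y) v(x)·∇Φ_δ(x-y) dy dx ≤ 2π ∫ Ψ f` (symmetrisation with the odd `∇Φ_δ`, then
`‖v x - v y‖ ‖∇Φ_δ(x-y)‖ ≤ dist x y (Ψ x + Ψ y) ‖∇Φ_δ(x-y)‖ ≤ π (Ψ x + Ψ y)`). [folklore] -/
theorem two_mul_integral_integral_inner_gradient_le {f : UnitAddTorus d → ℝ} (hfc : Continuous f)
    (hf0 : ∀ x, 0 ≤ f x) (hf1 : ∫ x, f x = 1) {v : UnitAddTorus d → EuclideanSpace ℝ d} (hvc : Continuous v)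
    {Ψ : UnitAddTorus d → ℝ} (hΨ0 : ∀ x, 0 ≤ Ψ x) (hΨ2 : MemLp Ψ 2 volume)
    (h2pt : ∀ x y, ‖v x - v y‖ ≤ dist x y * (Ψ x + Ψ y)) {δ : ℝ} (hδ : δ ≠ 0) :
    2 * ∫ x, f x * ∫ y, f y * ⟪v x, Torus.gradient (sinLogCost δ) (x - y)⟫_ℝ ≤
      2 * π * ∫ x, Ψ x * f x := by
  set g : UnitAddTorus d → EuclideanSpace ℝ d := Torus.gradient (sinLogCost δ) with hg
  have hgc : Continuous g := continuous_gradient_sinLogCost δ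
  have hgodd : ∀ z, g (-z) = -g z := gradient_sinLogCost_neg δ
  have hΨi : Integrable Ψ volume := hΨ2.integrable one_le_two
  have hfΨ : Integrable (fun x => f x * Ψ x) volume := integrable_continuous_mul_of_integrable hfc hΨi
  -- the kernel `K x y = f x f y ⟪v x, g(x - y)⟫` and its swap
  set K : UnitAddTorus d → UnitAddTorus d → ℝ := fun x y => f x * f y * ⟪v x, g (x - y)⟫_ℝ with hK
  have hKc : Continuous (uncurry K) :=
    ((hfc.comp continuous_fst).mul (hfc.comp continuous_snd)).mul
      ((hvc.comp continuous_fst).inner (hgc.comp (continuous_fst.sub continuous_snd)))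
  have hI : ∫ x, f x * ∫ y, f y * ⟪v x, g (x - y)⟫_ℝ = ∫ x, ∫ y, K x y := by
    refine integral_congr_ae (Eventually.of_forall fun x => ?_)
    simp only [hK]
    rw [← integral_const_mul]
    exact integral_congr_ae (Eventually.of_forall fun y => by ring)
  have hswap : ∫ x, ∫ y, K x y = ∫ x, ∫ y, K y x := by
    rw [integral_integral_swap (integrable_prod_of_continuous hKc)]
  have hKodd : ∀ x y, K y x = -(f x * f y * ⟪v y, g (x - y)⟫_ℝ) := by
    intro x y
    simp only [hK]
    rw [← neg_sub x y, hgodd, inner_neg_right]; ring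
  -- `2 I = ∫∫ f f ⟪v x - v y, g(x - y)⟫`
  have h2I : 2 * ∫ x, ∫ y, K x y = ∫ x, ∫ y, f x * f y * ⟪v x - v y, g (x - y)⟫_ℝ := by
    rw [two_mul]
    nth_rewrite 2 [hswap]
    have i1 : Integrable (fun x => ∫ y, K x y) volume := (integrable_prod_of_continuous hKc).integral_prod_left
    have hKc' : Continuous (uncurry fun x y => K y x) := hKc.comp (continuous_snd.prodMk continuous_fst)
    have i2 : Integrable (fun x => ∫ y, K y x) volume := (integrable_prod_of_continuous hKc').integral_prod_left
    rw [← integral_add i1 i2]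
    refine integral_congr_ae (Eventually.of_forall fun x => ?_)
    have j1 : Integrable (fun y => K x y) volume := (hKc.comp (continuous_const.prodMk continuous_id)).integrable_unitAddTorus
    have j2 : Integrable (fun y => K y x) volume := (hKc'.comp (continuous_const.prodMk continuous_id)).integrable_unitAddTorus
    simp only
    rw [← integral_add j1 j2]
    refine integral_congr_ae (Eventually.of_forall fun y => ?_)
    show K x y + K y x = f x * f y * ⟪v x - v y, g (x - y)⟫_ℝ
    rw [hKodd x y]
    simp only [hK, inner_sub_left]
    ring
  -- pointwise bound of the symmetrised kernel
  have hpt : ∀ x y, f x * f y * ⟪v x - v y, g (x - y)⟫_ℝ ≤ π * (f x * f y * (Ψ x + Ψ y)) := by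
    intro x y
    have h1 : ⟪v x - v y, g (x - y)⟫_ℝ ≤ ‖v x - v y‖ * ‖g (x - y)‖ := real_inner_le_norm _ _
    have h2 : ‖v x - v y‖ * ‖g (x - y)‖ ≤ π * (Ψ x + Ψ y) := by
      calc ‖v x - v y‖ * ‖g (x - y)‖ ≤ dist x y * (Ψ x + Ψ y) * ‖g (x - y)‖ :=
            mul_le_mul_of_nonneg_right (h2pt x y) (norm_nonneg _)
        _ = (‖x - y‖ * ‖g (x - y)‖) * (Ψ x + Ψ y) := by rw [dist_eq_norm]; ring
        _ ≤ π * (Ψ x + Ψ y) :=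
            mul_le_mul_of_nonneg_right (norm_mul_norm_gradient_sinLogCost_le hδ (x - y))
              (add_nonneg (hΨ0 x) (hΨ0 y))
    have hff : 0 ≤ f x * f y := mul_nonneg (hf0 x) (hf0 y)
    nlinarith
  -- integrate the bound
  have hinner : ∀ x, ∫ y, f x * f y * ⟪v x - v y, g (x - y)⟫_ℝ ≤ ∫ y, π * (f x * f y * (Ψ x + Ψ y)) := by
    intro x
    refine integral_mono ?_ ?_ (fun y => hpt x y)
    · exact (((continuous_const.mul hfc).mul ((continuous_const.sub hvc).inner
        (hgc.comp (continuous_const.sub continuous_id)))).integrable_unitAddTorus)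
    · have : (fun y => π * (f x * f y * (Ψ x + Ψ y))) = fun y => (π * f x * Ψ x) * f y + (π * f x) * (f y * Ψ y) := by
        funext y; ring
      rw [this]
      exact (hfc.integrable_unitAddTorus.const_mul _).add (hfΨ.const_mul _)
  have hrhs : ∀ x, ∫ y, π * (f x * f y * (Ψ x + Ψ y)) = π * (f x * Ψ x) + π * f x * ∫ y, f y * Ψ y := by
    intro x
    have : (fun y => π * (f x * f y * (Ψ x + Ψ y))) = fun y => (π * f x * Ψ x) * f y + (π * f x) * (f y * Ψ y) := by
      funext y; ring
    rw [this, integral_add ((hfc.integrable_unitAddTorus).const_mul _) (hfΨ.const_mul _),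
      integral_const_mul, integral_const_mul, hf1]
    ring
  have houter : ∫ x, ∫ y, f x * f y * ⟪v x - v y, g (x - y)⟫_ℝ ≤
      ∫ x, (π * (f x * Ψ x) + π * f x * ∫ y, f y * Ψ y) := by
    refine integral_mono ?_ ?_ (fun x => (hinner x).trans (le_of_eq (hrhs x)))
    · have hc : Continuous (uncurry fun x y => f x * f y * ⟪v x - v y, g (x - y)⟫_ℝ) :=
        ((hfc.comp continuous_fst).mul (hfc.comp continuous_snd)).mul
          (((hvc.comp continuous_fst).sub (hvc.comp continuous_snd)).inner
            (hgc.comp (continuous_fst.sub continuous_snd)))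
      exact (integrable_prod_of_continuous hc).integral_prod_left
    · exact (hfΨ.const_mul π).add ((hfc.integrable_unitAddTorus.const_mul _).mul_const _)
  have hval : ∫ x, (π * (f x * Ψ x) + π * f x * ∫ y, f y * Ψ y) = 2 * π * ∫ x, Ψ x * f x := by
    rw [integral_add (hfΨ.const_mul π) ((hfc.integrable_unitAddTorus.const_mul _).mul_const _),
      integral_const_mul, integral_mul_const, integral_const_mul, hf1]
    have : ∫ x, f x * Ψ x = ∫ x, Ψ x * f x := integral_congr_ae (Eventually.of_forall fun x => mul_comm _ _)
    rw [this]; ring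
  calc 2 * ∫ x, f x * ∫ y, f y * ⟪v x, g (x - y)⟫_ℝ = 2 * ∫ x, ∫ y, K x y := by rw [hI]
    _ = ∫ x, ∫ y, f x * f y * ⟪v x - v y, g (x - y)⟫_ℝ := h2I
    _ ≤ _ := houter
    _ = 2 * π * ∫ x, Ψ x * f x := hval

/-! ## The diffusion term -/

/-- **The diffusion slice bound.** For a continuous probability density `f` and `κ = δ²`
(`δ ≠ 0`): `2 ∫ f(x) ∫ f(y) κ ΔΦ_δ(x-y) dy dx ≤ 4π² d` (`ΔΦ_δ ≤ 2π²d/δ²`). [folklore] -/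
theorem two_mul_integral_integral_laplacian_le {f : UnitAddTorus d → ℝ} (hfc : Continuous f)
    (hf0 : ∀ x, 0 ≤ f x) (hf1 : ∫ x, f x = 1) {δ κ : ℝ} (hδ : δ ≠ 0) (hκ : κ = δ ^ 2) :
    2 * ∫ x, f x * ∫ y, f y * (κ * FunctionSpaces.Torus.laplacian (sinLogCost δ) (x - y)) ≤ 4 * π ^ 2 * Fintype.card d := by
  have hLc : Continuous (FunctionSpaces.Torus.laplacian (sinLogCost δ) : UnitAddTorus d → ℝ) := continuous_laplacian_sinLogCost δ
  have hκ0 : 0 ≤ κ := by rw [hκ]; positivity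
  have hbd : ∀ z : UnitAddTorus d, κ * FunctionSpaces.Torus.laplacian (sinLogCost δ) z ≤ 2 * π ^ 2 * Fintype.card d := by
    intro z
    calc κ * FunctionSpaces.Torus.laplacian (sinLogCost δ) z ≤ κ * (2 * π ^ 2 * Fintype.card d / δ ^ 2) :=
          mul_le_mul_of_nonneg_left (laplacian_sinLogCost_le hδ z) hκ0
      _ = 2 * π ^ 2 * Fintype.card d := by rw [hκ]; field_simp
  have hinner : ∀ x, ∫ y, f y * (κ * FunctionSpaces.Torus.laplacian (sinLogCost δ) (x - y)) ≤ 2 * π ^ 2 * Fintype.card d := by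
    intro x
    calc ∫ y, f y * (κ * FunctionSpaces.Torus.laplacian (sinLogCost δ) (x - y)) ≤ ∫ y, f y * (2 * π ^ 2 * Fintype.card d) := by
          refine integral_mono ?_ (hfc.integrable_unitAddTorus.mul_const _) fun y =>
            mul_le_mul_of_nonneg_left (hbd _) (hf0 y)
          exact (hfc.mul (continuous_const.mul (hLc.comp (continuous_const.sub continuous_id)))).integrable_unitAddTorus
      _ = 2 * π ^ 2 * Fintype.card d := by rw [integral_mul_const, hf1, one_mul]
  have houter : ∫ x, f x * ∫ y, f y * (κ * FunctionSpaces.Torus.laplacian (sinLogCost δ) (x - y)) ≤ 2 * π ^ 2 * Fintype.card d := by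
    calc ∫ x, f x * ∫ y, f y * (κ * FunctionSpaces.Torus.laplacian (sinLogCost δ) (x - y))
        ≤ ∫ x, f x * (2 * π ^ 2 * Fintype.card d) := by
          refine integral_mono ?_ (hfc.integrable_unitAddTorus.mul_const _) fun x =>
            mul_le_mul_of_nonneg_left (hinner x) (hf0 x)
          have hc : Continuous (uncurry fun x y : UnitAddTorus d => f y * (κ * FunctionSpaces.Torus.laplacian (sinLogCost δ) (x - y))) :=
            (hfc.comp continuous_snd).mul (continuous_const.mul (hLc.comp (continuous_fst.sub continuous_snd)))
          exact integrable_continuous_mul_of_integrable hfc ((integrable_prod_of_continuous hc).integral_prod_left)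
      _ = 2 * π ^ 2 * Fintype.card d := by rw [integral_mul_const, hf1, one_mul]
  linarith

end Torus

end Literature.Analysis.FluidPDE
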